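import Literature.NumberTheory.LFunctions.ConreyIwaniec2002MoebiusSqSum
import HarnessLib

/-!
# Conrey–Iwaniec (2002) §4, (4.27)–(4.32): the Ramanujan-sum series `Σ_{(c,q)=v} r_c(h) c⁻²`
# of the main-term coefficients `σ(h)` in convolution form

B. Conrey, H. Iwaniec, *Spacing of zeros of Hecke L-functions and the class number problem*,
Acta Arith. 103 (2002) 259–312, §4, (4.27)–(4.32) [held text `paper:arxiv-math_0111012`,
p0012–p0013]. Second arithmetic toolkit file for the registered stub S3e `stub_sigma_genus` of the
line `theta-circle-method` (cell `landau-siegel/ls-inputs`). Everything here is PROVED (four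
plumbing definitions with bodies, theorems).

Print: for a squarefree `q = vw` and `h ≥ 1`,
`v Σ_{(c,q)=v} r_c(h) c⁻² = μ(v/(h,v)) ((h,v)/v) ∏_{p^α ∥ h, p∣v}(1 − p^{−α} − p^{−α−1}) (ζ_q(2)/ζ(2)) Σ_{d∣h,(d,q)=1} d⁻¹`
((4.28)–(4.32)), `r_c(h) = Σ_{d∣(c,h)} d μ(c/d)` (4.28). We prove the same evaluation in
CONVOLUTION FORM, which is what the Dirichlet series (4.34) and the bound `|σ(h)| ≤ 2ℓ²σ₋₁(h)`
((6.20), the tree's `IsCISigma`) consume: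

* `jFun w = n ↦ [(n,w)=1] n⁻¹`, `kFun v = n ↦ [n∣v] μ(n) n`, `mFun v w = ζ * jFun w * kFun v`
  (so `mFun v w (h) = Σ_{d∣h,(d,w)=1} d⁻¹ ∏_{p∣(d,v)}(1 − p²)`, `jFun_mul_kFun_apply`), and the
  bound **`|mFun v w h| ≤ (h,v)·σ₋₁(h)`** (`abs_mFun_le`: `mFun = (ζ * kFun v) * jFun w`,
  `|(ζ * kFun v)(m)| = ∏_{p∣(m,v)}(p − 1) ≤ (m,v) ≤ (h,v)`, `|jFun w n| ≤ n⁻¹`);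
* `rcSum q v h = Σ_{c ≥ 1,(c,q)=v} r_c(h) c⁻²` and **`rcSum_eq`**: for squarefree `q`, `v ∣ q`,
  `w = q/v`, `h ≠ 0`: `rcSum q v h = κ · μ(v) · mFun v w h / v²`, `κ = moebiusSqSum q`; proof =
  (4.28)–(4.31) reorganised (Kluyver's form, `c = de`, `(de,q) = v ⟺ (d,w)=1 ∧ v/(d,v) ∣ e ∧ (e,w)=1`,
  `e = (v/a)e'`, `moebiusSqSum (q/a) = ∏_{p∣a}(1 − p⁻²)·moebiusSqSum q`).
The Dirichlet series (4.34) of `mFun` is the next file. «The programme SEARCHES and TYPES; no claim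
about Landau–Siegel zeros, Theorems 1–2 of arXiv:2211.02515 or a repaired Margin232 until a kernel
theorem says so.»
-/

noncomputable section

open scoped ArithmeticFunction.Moebius ArithmeticFunction.zeta
open Finset ArithmeticFunction Literature.NumberTheory.Sieve

namespace Literature.NumberTheory.LFunctions

namespace ConreyIwaniec2002

namespace SigmaGenus

/-! ### The arithmetic functions `j_w`, `k_v` and `m_{v,w} = ζ * j_w * k_v` -/

/-- `|j_w(n)| ≤ n⁻¹`. [folklore] -/
private theorem abs_jFun_le (w n : ℕ) : |jFun w n| ≤ (n : ℝ)⁻¹ := by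
  rw [jFun_apply]
  split_ifs
  · rw [abs_of_nonneg (by positivity)]
  · rw [abs_zero]; positivity

/-- The divisors of `d` dividing `v` are the divisors of `(d, v)`. [folklore] -/
private theorem filter_dvd_divisors_eq_divisors_gcd {d : ℕ} (hd : d ≠ 0) (v : ℕ) :
    d.divisors.filter (fun y ↦ y ∣ v) = (Nat.gcd d v).divisors := by
  rw [← Nat.divisors_filter_dvd_of_dvd hd (Nat.gcd_dvd_left d v)]
  refine Finset.filter_congr fun y hy ↦ ?_
  have hyd : y ∣ d := Nat.dvd_of_mem_divisors hy
  exact ⟨fun h ↦ Nat.dvd_gcd hyd h, fun h ↦ h.trans (Nat.gcd_dvd_right d v)⟩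

/-- `(ζ * k_v)(m) = Σ_{y ∣ (m,v)} μ(y) y = ∏_{p ∣ (m,v)}(1 − p)` for squarefree `v`. [folklore] -/
private theorem zeta_mul_kFun_apply {v : ℕ} (hv : Squarefree v) {m : ℕ} (hm : m ≠ 0) :
    ((ζ : ArithmeticFunction ℝ) * kFun v) m = ∏ p ∈ (Nat.gcd m v).primeFactors, (1 - (p : ℝ)) := by
  rw [coe_zeta_mul_apply]
  have hg : Squarefree (Nat.gcd m v) := hv.squarefree_of_dvd (Nat.gcd_dvd_right m v)
  have h1 : ∑ i ∈ m.divisors, kFun v i = ∑ i ∈ m.divisors.filter (fun y ↦ y ∣ v), (μ i : ℝ) * i := by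
    rw [Finset.sum_filter]; rfl
  have key := (isMultiplicative_id.natCast (R := ℝ)).prodPrimeFactors_one_sub_of_squarefree _ hg
  simp only [natCoe_apply, id_apply] at key
  rw [h1, filter_dvd_divisors_eq_divisors_gcd hm, key]

/-- `|(ζ * k_v)(m)| ≤ (m, v)` for squarefree `v`. [folklore] -/
private theorem abs_zeta_mul_kFun_le {v : ℕ} (hv : Squarefree v) {m : ℕ} (hm : m ≠ 0) :
    |((ζ : ArithmeticFunction ℝ) * kFun v) m| ≤ (Nat.gcd m v : ℝ) := by
  have hg : Squarefree (Nat.gcd m v) := hv.squarefree_of_dvd (Nat.gcd_dvd_right m v)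
  rw [zeta_mul_kFun_apply hv hm, Finset.abs_prod]
  calc ∏ p ∈ (Nat.gcd m v).primeFactors, |1 - (p : ℝ)|
      ≤ ∏ p ∈ (Nat.gcd m v).primeFactors, (p : ℝ) := by
        refine Finset.prod_le_prod (fun p _ ↦ abs_nonneg _) fun p hp ↦ ?_
        have h1 : (1 : ℝ) ≤ p := by exact_mod_cast (Nat.prime_of_mem_primeFactors hp).one_lt.le
        rw [abs_sub_comm, abs_of_nonneg (by linarith)]
        linarith
    _ = (Nat.gcd m v : ℝ) := by
        rw [← Nat.cast_prod, Nat.prod_primeFactors_of_squarefree hg]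

/-- **`|m_{v,w}(h)| ≤ (h,v)·σ₋₁(h)`** for squarefree `v ≠ 0`
(`m = (ζ * k_v) * j_w`, `|(ζ * k_v)(m)| ≤ (m,v) ≤ (h,v)` for `m ∣ h`, `|j_w(n)| ≤ n⁻¹`).
[cite: ConreyIwaniec2002, §4 (4.32), §6 (6.20)] -/
theorem abs_mFun_le {v : ℕ} (hv : Squarefree v) (w h : ℕ) :
    |mFun v w h| ≤ (Nat.gcd h v : ℝ) * ∑ d ∈ h.divisors, (d : ℝ)⁻¹ := by
  rcases Nat.eq_zero_or_pos h with rfl | hh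
  · simp [mFun]
  have hv0 : v ≠ 0 := hv.ne_zero
  have hmul : mFun v w = ((ζ : ArithmeticFunction ℝ) * kFun v) * jFun w := by
    rw [mFun]; ring
  rw [hmul, mul_apply, Nat.sum_divisorsAntidiagonal (f := fun x y ↦
    ((ζ : ArithmeticFunction ℝ) * kFun v) x * jFun w y),
    ← Nat.sum_div_divisors h (fun d ↦ (d : ℝ)⁻¹), Finset.mul_sum]
  refine (Finset.abs_sum_le_sum_abs _ _).trans (Finset.sum_le_sum fun i hi ↦ ?_)
  have hi0 : i ≠ 0 := Nat.ne_of_gt (Nat.pos_of_mem_divisors hi)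
  have hid : i ∣ h := Nat.dvd_of_mem_divisors hi
  rw [abs_mul]
  have h1 : |((ζ : ArithmeticFunction ℝ) * kFun v) i| ≤ (Nat.gcd h v : ℝ) := by
    refine (abs_zeta_mul_kFun_le hv hi0).trans ?_
    have hdvd : Nat.gcd i v ∣ Nat.gcd h v := Nat.gcd_dvd_gcd_of_dvd_left v hid
    exact_mod_cast Nat.le_of_dvd (Nat.gcd_pos_of_pos_right h (Nat.pos_of_ne_zero hv0)) hdvd
  exact mul_le_mul h1 (abs_jFun_le w (h / i)) (abs_nonneg _) (by positivity)

/-- `(j_w * k_v)(d) = [(d,w)=1] d⁻¹ ∏_{p ∣ (d,v)}(1 − p²)` for squarefree `v` coprime to `w`, `d ≠ 0`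
(the inner sum of (4.31)). [cite: ConreyIwaniec2002, §4 (4.31)] -/
theorem jFun_mul_kFun_apply {v w : ℕ} (hv : Squarefree v) (hvw : v.Coprime w) {d : ℕ} (hd : d ≠ 0) :
    (jFun w * kFun v) d =
      if d.Coprime w then (d : ℝ)⁻¹ * ∏ p ∈ (Nat.gcd d v).primeFactors, (1 - (p : ℝ) ^ 2) else 0 := by
  rw [mul_apply, Nat.sum_divisorsAntidiagonal' (f := fun x y ↦ jFun w x * kFun v y)]
  by_cases hdw : d.Coprime w
  · rw [if_pos hdw]
    have hg : Squarefree (Nat.gcd d v) := hv.squarefree_of_dvd (Nat.gcd_dvd_right d v)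
    have key := (isMultiplicative_pow (k := 2)).natCast (R := ℝ)
      |>.prodPrimeFactors_one_sub_of_squarefree _ hg
    simp only [natCoe_apply, pow_apply, OfNat.ofNat_ne_zero, false_and, if_false, Nat.cast_pow] at key
    rw [key, ← filter_dvd_divisors_eq_divisors_gcd hd, Finset.sum_filter, Finset.mul_sum]
    refine Finset.sum_congr rfl fun y hy ↦ ?_
    have hyd : y ∣ d := Nat.dvd_of_mem_divisors hy
    have hy0 : y ≠ 0 := Nat.ne_of_gt (Nat.pos_of_mem_divisors hy)
    have hcop' : (d / y).Coprime w := Nat.Coprime.coprime_dvd_left (Nat.div_dvd_of_dvd hyd) hdw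
    rw [jFun_apply, if_pos hcop', kFun_apply]
    split_ifs with hyv
    · rw [Nat.cast_div hyd (by exact_mod_cast hy0)]
      have hd0 : (d : ℝ) ≠ 0 := by exact_mod_cast hd
      have hy0' : (y : ℝ) ≠ 0 := by exact_mod_cast hy0
      field_simp
    · simp
  · rw [if_neg hdw]
    refine Finset.sum_eq_zero fun y hy ↦ ?_
    have hyd : y ∣ d := Nat.dvd_of_mem_divisors hy
    rw [jFun_apply, kFun_apply]
    by_cases hyv : y ∣ v
    · have hyw : y.Coprime w := Nat.Coprime.coprime_dvd_left hyv hvw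
      have hncop : ¬ (d / y).Coprime w := by
        intro h
        apply hdw
        have := Nat.Coprime.mul_left hyw h
        rwa [Nat.mul_div_cancel' hyd] at this
      rw [if_neg hncop, zero_mul]
    · rw [if_neg hyv, mul_zero]

/-! ### `Σ_{(c,q)=v} r_c(h) c⁻²` -/

/-- Kluyver's `r_c(h) = Σ_{d ∣ h, d ∣ c} μ(c/d) d`, written over the divisors of `h`. [folklore] -/
private theorem ramanujanDivisorSum_eq_sum_divisors {h : ℕ} (hh : h ≠ 0) {c : ℕ} (hc : c ≠ 0) :
    (ramanujanDivisorSum h c : ℝ) =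
      ∑ d ∈ h.divisors, if d ∣ c then (μ (c / d) : ℝ) * d else 0 := by
  rw [ramanujanDivisorSum_apply,
    Nat.sum_divisorsAntidiagonal' (f := fun x y ↦ (μ x : ℤ) * (if y ∣ h then (y : ℤ) else 0))]
  push_cast
  have h1 : ∑ i ∈ c.divisors, (μ (c / i) : ℝ) * (if i ∣ h then (i : ℝ) else 0) =
      ∑ i ∈ c.divisors.filter (fun y ↦ y ∣ h), (μ (c / i) : ℝ) * i := by
    rw [Finset.sum_filter]
    refine Finset.sum_congr rfl fun i _ ↦ ?_
    split_ifs <;> simp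
  have h2 : ∑ d ∈ h.divisors, (if d ∣ c then (μ (c / d) : ℝ) * d else 0) =
      ∑ d ∈ h.divisors.filter (fun y ↦ y ∣ c), (μ (c / d) : ℝ) * d := by
    rw [Finset.sum_filter]
  rw [h1, h2, filter_dvd_divisors_eq_divisors_gcd hc, filter_dvd_divisors_eq_divisors_gcd hh,
    Nat.gcd_comm]

/-- The summand of `rcSum`, expanded over the divisors of `h`. [folklore] -/
private theorem rcSum_term_eq {q v h : ℕ} (hh : h ≠ 0) (c : ℕ) :
    (if Nat.gcd c q = v then (ramanujanDivisorSum h c : ℝ) / (c : ℝ) ^ 2 else 0) =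
      ∑ d ∈ h.divisors, (if d ∣ c then
        (if Nat.gcd c q = v then (μ (c / d) : ℝ) * d / (c : ℝ) ^ 2 else 0) else 0) := by
  rcases Nat.eq_zero_or_pos c with rfl | hc
  · simp
  · by_cases hg : Nat.gcd c q = v
    · simp only [hg, if_true]
      rw [ramanujanDivisorSum_eq_sum_divisors hh hc.ne', Finset.sum_div]
      refine Finset.sum_congr rfl fun d _ ↦ ?_
      split_ifs
      · rfl
      · simp
    · simp only [hg, if_false]
      rw [Finset.sum_eq_zero]
      intro d _
      split_ifs <;> rfl

/-- `|μ(e)| ≤ 1` in `ℝ` (cf. the tree's `abs_moebius_real_le_one`, not imported here). [folklore] -/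
private theorem abs_moebius_cast_le_one' (e : ℕ) : |(μ e : ℝ)| ≤ 1 := by
  have h := abs_moebius_le_one (n := e)
  exact_mod_cast h

/-- The pieces `F_d(c) = [d ∣ c][(c,q)=v] μ(c/d) d c⁻²` are absolutely summable (`|F_d(c)| ≤ d c⁻²`).
[folklore] -/
private theorem summable_rcSum_piece (q v d : ℕ) :
    Summable (fun c : ℕ ↦ (if d ∣ c then
      (if Nat.gcd c q = v then (μ (c / d) : ℝ) * d / (c : ℝ) ^ 2 else 0) else 0)) := by
  refine Summable.of_norm_bounded (g := fun c : ℕ ↦ (d : ℝ) * (1 / (c : ℝ) ^ 2))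
    ((Real.summable_one_div_nat_pow.mpr one_lt_two).mul_left _) fun c ↦ ?_
  rw [Real.norm_eq_abs]
  have hnn : (0 : ℝ) ≤ (d : ℝ) * (1 / (c : ℝ) ^ 2) := by positivity
  split_ifs
  · rw [abs_div, abs_mul, abs_of_nonneg (show (0 : ℝ) ≤ (d : ℝ) by positivity),
      abs_of_nonneg (by positivity : (0 : ℝ) ≤ (c : ℝ) ^ 2)]
    calc |(μ (c / d) : ℝ)| * d / (c : ℝ) ^ 2 ≤ 1 * d / (c : ℝ) ^ 2 := by
          gcongr
          exact abs_moebius_cast_le_one' _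
      _ = (d : ℝ) * (1 / (c : ℝ) ^ 2) := by ring
  · rw [abs_zero]; exact hnn
  · rw [abs_zero]; exact hnn

/-- The summand of `rcSum q v h` is absolutely summable (`h ≠ 0`; `|r_c(h)| ≤ σ(h)`, terms
`O(c⁻²)`), so the series (4.27) converges absolutely. [cite: ConreyIwaniec2002, §4 (4.27)] -/
theorem summable_rcSum_term (q v : ℕ) {h : ℕ} (hh : h ≠ 0) :
    Summable (fun c : ℕ ↦
      if Nat.gcd c q = v then (ramanujanDivisorSum h c : ℝ) / (c : ℝ) ^ 2 else 0) := by
  have hs := summable_sum (s := h.divisors) (f := fun d (c : ℕ) ↦ (if d ∣ c then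
      (if Nat.gcd c q = v then (μ (c / d) : ℝ) * d / (c : ℝ) ^ 2 else 0) else 0))
    (fun d _ ↦ summable_rcSum_piece q v d)
  refine hs.congr fun c ↦ ?_
  rw [rcSum_term_eq hh c]

/-- `Σ_c F_d(c) = d⁻¹ Σ_e [(de,q)=v] μ(e) e⁻²` (substitute `c = de`). [folklore] -/
private theorem tsum_rcSum_piece_eq (q v : ℕ) {d : ℕ} (hd : d ≠ 0) :
    ∑' c : ℕ, (if d ∣ c then
        (if Nat.gcd c q = v then (μ (c / d) : ℝ) * d / (c : ℝ) ^ 2 else 0) else 0) =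
      (d : ℝ)⁻¹ * ∑' e : ℕ, (if Nat.gcd (d * e) q = v then (μ e : ℝ) / (e : ℝ) ^ 2 else 0) := by
  rw [tsum_ite_dvd_eq d hd, ← tsum_mul_left]
  refine tsum_congr fun e ↦ ?_
  rw [Nat.mul_div_cancel_left e (Nat.pos_of_ne_zero hd)]
  have hd0 : (d : ℝ) ≠ 0 := by exact_mod_cast hd
  split_ifs
  · push_cast
    rcases Nat.eq_zero_or_pos e with rfl | he
    · simp
    · have he0 : (e : ℝ) ≠ 0 := by exact_mod_cast he.ne'
      field_simp
  · simp

/-! ### `(de, q) = v` for squarefree `q` -/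

/-- `v ∣ de ⟹ v/(d,v) ∣ e`. [folklore] -/
private theorem div_gcd_dvd_of_dvd_mul {v d e : ℕ} (hd : d ≠ 0) (h : v ∣ d * e) : v / Nat.gcd d v ∣ e := by
  set g := Nat.gcd d v with hg
  have hg0 : 0 < g := Nat.gcd_pos_of_pos_left v (Nat.pos_of_ne_zero hd)
  have hgd : g ∣ d := Nat.gcd_dvd_left d v
  have hgv : g ∣ v := Nat.gcd_dvd_right d v
  have hcop : (d / g).Coprime (v / g) := by
    rw [hg]; exact Nat.coprime_div_gcd_div_gcd hg0
  have h1 : v / g ∣ (d / g) * e := by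
    have : v / g * g ∣ (d / g * e) * g := by
      rw [Nat.div_mul_cancel hgv, mul_assoc, mul_comm e g, ← mul_assoc, Nat.div_mul_cancel hgd]
      exact h
    exact Nat.dvd_of_mul_dvd_mul_right hg0 this
  exact hcop.symm.dvd_of_dvd_mul_left h1

/-- For squarefree `q`, `v ∣ q`, `w = q/v`, `d ≠ 0`:
`(de, q) = v ⟺ (d,w) = 1 ∧ v/(d,v) ∣ e ∧ (e,w) = 1` (the bookkeeping of (4.29)).
[cite: ConreyIwaniec2002, §4 (4.29)] -/
theorem gcd_mul_eq_iff {q v : ℕ} (hq : Squarefree q) (hv : v ∣ q) {d : ℕ} (hd : d ≠ 0) (e : ℕ) :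
    Nat.gcd (d * e) q = v ↔ d.Coprime (q / v) ∧ v / Nat.gcd d v ∣ e ∧ e.Coprime (q / v) := by
  set w := q / v with hw
  have hvw : v * w = q := Nat.mul_div_cancel' hv
  have hcop : v.Coprime w := Nat.coprime_of_squarefree_mul (hvw.symm ▸ hq)
  have hsplit : Nat.gcd (d * e) q = Nat.gcd (d * e) v * Nat.gcd (d * e) w := by
    rw [← hvw]; exact Nat.Coprime.gcd_mul (d * e) hcop
  constructor
  · intro H
    rw [hsplit] at H
    have h2 : Nat.gcd (d * e) w = 1 := by
      have hdv : Nat.gcd (d * e) w ∣ v := ⟨Nat.gcd (d * e) v, by rw [mul_comm]; exact H.symm⟩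
      have hdw : Nat.gcd (d * e) w ∣ w := Nat.gcd_dvd_right _ _
      exact Nat.eq_one_of_dvd_coprimes hcop hdv hdw
    rw [h2, mul_one] at H
    have hde : (d * e).Coprime w := h2
    refine ⟨Nat.Coprime.coprime_mul_right hde, ?_, Nat.Coprime.coprime_mul_left hde⟩
    exact div_gcd_dvd_of_dvd_mul hd (H ▸ Nat.gcd_dvd_left (d * e) v)
  · rintro ⟨h1, h2, h3⟩
    rw [hsplit]
    have hde : (d * e).Coprime w := Nat.Coprime.mul_left h1 h3
    rw [show Nat.gcd (d * e) w = 1 from hde, mul_one]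
    apply Nat.gcd_eq_right
    have hg : Nat.gcd d v ∣ d := Nat.gcd_dvd_left d v
    calc v = Nat.gcd d v * (v / Nat.gcd d v) := (Nat.mul_div_cancel' (Nat.gcd_dvd_right d v)).symm
      _ ∣ d * e := mul_dvd_mul hg h2

/-- **The inner series**: for squarefree `q`, `v ∣ q`, `w = q/v`, `d ≠ 0`, `a = (d,v)`:
`Σ_e [(de,q)=v] μ(e) e⁻² = [(d,w)=1] · μ(v/a) (v/a)⁻² · Σ_{(e,q/a)=1} μ(e) e⁻²` ((4.29)–(4.30)).
[cite: ConreyIwaniec2002, §4 (4.29)–(4.30)] -/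
theorem tsum_gcd_mul_eq {q v : ℕ} (hq : Squarefree q) (hv : v ∣ q) {d : ℕ} (hd : d ≠ 0) :
    ∑' e : ℕ, (if Nat.gcd (d * e) q = v then (μ e : ℝ) / (e : ℝ) ^ 2 else 0) =
      if d.Coprime (q / v) then
        (μ (v / Nat.gcd d v) : ℝ) / ((v / Nat.gcd d v : ℕ) : ℝ) ^ 2 *
          moebiusSqSum (q / Nat.gcd d v)
      else 0 := by
  set w := q / v with hw
  set a := Nat.gcd d v with ha
  set b := v / a with hb
  have hvw : v * w = q := Nat.mul_div_cancel' hv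
  have hvcop : v.Coprime w := Nat.coprime_of_squarefree_mul (hvw.symm ▸ hq)
  have hav : a ∣ v := Nat.gcd_dvd_right d v
  have hab : a * b = v := Nat.mul_div_cancel' hav
  have hbv : b ∣ v := Dvd.intro_left a hab
  have hvsq : Squarefree v := hq.squarefree_of_dvd hv
  have hbsq : Squarefree b := hvsq.squarefree_of_dvd hbv
  have hb0 : b ≠ 0 := hbsq.ne_zero
  have hbw : b.Coprime w := Nat.Coprime.coprime_dvd_left hbv hvcop
  have hqa : q / a = w * b := by
    have ha0 : 0 < a := Nat.gcd_pos_of_pos_left v (Nat.pos_of_ne_zero hd)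
    apply Nat.div_eq_of_eq_mul_left ha0
    rw [← hvw, ← hab]; ring
  by_cases hdw : d.Coprime w
  · rw [if_pos hdw]
    have step1 : ∀ e : ℕ, (if Nat.gcd (d * e) q = v then (μ e : ℝ) / (e : ℝ) ^ 2 else 0) =
        if b ∣ e then msTerm w e else 0 := by
      intro e
      rw [msTerm_def]
      by_cases hbe : b ∣ e
      · rw [if_pos hbe]
        by_cases hew : e.Coprime w
        · rw [if_pos hew, if_pos ((gcd_mul_eq_iff hq hv hd e).mpr ⟨hdw, hbe, hew⟩)]
        · rw [if_neg hew, if_neg (fun H ↦ hew ((gcd_mul_eq_iff hq hv hd e).mp H).2.2)]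
      · rw [if_neg hbe, if_neg (fun H ↦ hbe ((gcd_mul_eq_iff hq hv hd e).mp H).2.1)]
    have step3 : ∀ e : ℕ, msTerm w (b * e) = (μ b : ℝ) / (b : ℝ) ^ 2 * msTerm (w * b) e := by
      intro e
      rw [msTerm_def, msTerm_def, moebius_mul_eq]
      have hiff : (b * e).Coprime w ↔ e.Coprime w :=
        ⟨fun h ↦ Nat.Coprime.coprime_mul_left h, fun h ↦ Nat.Coprime.mul_left hbw h⟩
      have hiff2 : e.Coprime (w * b) ↔ e.Coprime w ∧ e.Coprime b := Nat.coprime_mul_iff_right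
      have hb0' : (b : ℝ) ≠ 0 := by exact_mod_cast hb0
      by_cases hew : e.Coprime w
      · rw [if_pos (hiff.mpr hew)]
        by_cases heb : e.Coprime b
        · rw [if_pos heb.symm, if_pos (hiff2.mpr ⟨hew, heb⟩)]
          push_cast
          rcases Nat.eq_zero_or_pos e with rfl | he
          · simp
          · have he0 : (e : ℝ) ≠ 0 := by exact_mod_cast he.ne'
            field_simp
        · rw [if_neg (fun h ↦ heb h.symm), if_neg (fun h ↦ heb (hiff2.mp h).2)]
          simp
      · rw [if_neg (fun h ↦ hew (hiff.mp h)), if_neg (fun h ↦ hew (hiff2.mp h).1)]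
        simp
    rw [tsum_congr step1, tsum_ite_dvd_eq b hb0, tsum_congr step3, tsum_mul_left, hqa]
    rfl
  · rw [if_neg hdw]
    have : ∀ e : ℕ, (if Nat.gcd (d * e) q = v then (μ e : ℝ) / (e : ℝ) ^ 2 else 0) = 0 := by
      intro e
      rw [if_neg (fun H ↦ hdw ((gcd_mul_eq_iff hq hv hd e).mp H).1)]
    rw [tsum_congr this, tsum_zero]

/-- **(4.27)–(4.32) in convolution form**: for squarefree `q`, `v ∣ q`, `w = q/v` and `h ≠ 0`,
`Σ_{c ≥ 1, (c,q)=v} r_c(h) c⁻² = κ · μ(v) · m_{v,w}(h) / v²` with `κ = Σ_{(e,q)=1} μ(e)e⁻²`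
(`= ζ_q(2)/ζ(2)`) and `m_{v,w} = ζ * j_w * k_v`. [cite: ConreyIwaniec2002, §4 (4.27)–(4.32)] -/
theorem rcSum_eq {q v h : ℕ} (hq : Squarefree q) (hv : v ∣ q) (hh : h ≠ 0) :
    rcSum q v h = moebiusSqSum q * (μ v : ℝ) * mFun v (q / v) h / (v : ℝ) ^ 2 := by
  set w := q / v with hw
  have hvw : v * w = q := Nat.mul_div_cancel' hv
  have hvcop : v.Coprime w := Nat.coprime_of_squarefree_mul (hvw.symm ▸ hq)
  have hvsq : Squarefree v := hq.squarefree_of_dvd hv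
  have hv0 : v ≠ 0 := hvsq.ne_zero
  have hv0' : (v : ℝ) ≠ 0 := by exact_mod_cast hv0
  unfold rcSum
  rw [tsum_congr (rcSum_term_eq (q := q) (v := v) hh),
    Summable.tsum_finsetSum (fun d _ ↦ summable_rcSum_piece q v d), mFun_apply,
    Finset.mul_sum, Finset.sum_div]
  refine Finset.sum_congr rfl fun d hdh ↦ ?_
  have hd0 : d ≠ 0 := Nat.ne_of_gt (Nat.pos_of_mem_divisors hdh)
  have hd0' : (d : ℝ) ≠ 0 := by exact_mod_cast hd0
  rw [tsum_rcSum_piece_eq q v hd0, tsum_gcd_mul_eq hq hv hd0, jFun_mul_kFun_apply hvsq hvcop hd0]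
  by_cases hdw : d.Coprime w
  · rw [if_pos hdw, if_pos hdw]
    set a := Nat.gcd d v with ha
    have hav : a ∣ v := Nat.gcd_dvd_right d v
    have haq : a ∣ q := hav.trans hv
    have hasq : Squarefree a := hvsq.squarefree_of_dvd hav
    have ha0 : a ≠ 0 := hasq.ne_zero
    have ha0' : (a : ℝ) ≠ 0 := by exact_mod_cast ha0
    rw [moebiusSqSum_div_eq hq haq, prod_one_sub_sq_eq hasq, ← moebius_mul_moebius_of_dvd hvsq hav,
      Nat.cast_div hav ha0']
    field_simp
  · rw [if_neg hdw, if_neg hdw]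
    simp

end SigmaGenus

end ConreyIwaniec2002

end Literature.NumberTheory.LFunctions

end

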